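import Summits.RiemannHypothesis.RiemannHypothesis.Theorems.PfPersistenceThinTubeTrace
import Summits.RiemannHypothesis.RiemannHypothesis.Theorems.PfPersistenceExpSumMeanSquare
import HarnessLib

/-!
# Vanishing-tube trace: entry tubes that get small at large heights have dial-space trace `{ζ}` (pub-rhpf, typer gen 9)

**HONEST FRAMING. This is a long-odds MECHANISM SEARCH; no RH claims.** RH-free typing: every statement below is
about the SHAPE of entry tubes `entryTube r d₀` (`PfPersistenceEntryTubes`) on the arithmetic dial space; `ζ`'s
all-window positivity is never assumed except as the explicit hypothesis of the separation corollary.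

`PfPersistenceThinTubeTrace` computed the trace of tubes that are THIN IN THE RANK (`N · r → 0` at fixed sampling
heights; these tubes are not G1-contU: `not_inG1contU_entryTube_of_thin`). Here the radius may stay FLOORED at every
bounded height (as the U-clause `DialEscape` demands) and only has to be small at SOME large ranks of every LARGE
sampling height: `SmallAtHighSampling r` (`∃ ρ → 0, ∀ Q n, ∃ N ≥ n, r(samplingWindow Q N) ≤ ρ_Q`).

* §1 DIAGONAL ENTRIES at the sampling windows: `(d_w − d_{w₀})_{nn} = −2 C(n) + S(n)/(πn)` with the cosine sum
  `C(n) = Σ_q Δ_q (1 − log q/ℓ_Q) cos(n ω_q)` and a bounded sine sum `S(n)` (`diagDev_eq`).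
* §2 TRACE THEOREM (`datumOf_eq_of_mem_entryTube_of_small`, PROVED): tube membership bounds `|C(n)| ≤ ρ_Q`
  eventually in `n`; the mean-square coefficient bound (`cosSum_coeff_le`) gives `|Δ_q|(1 − log q/ℓ_Q) ≤ 2ρ_Q` and
  `|Δ_0 + Δ_1| ≤ ρ_Q`; letting the height `Q → ∞` kills every `Δ_q`: the dial-space trace of the tube is `{centre}`.
* §3 COROLLARIES: `entryTube r ζ ∩ dialSpace = {ζ}` and `Separates (entryTube r ζ) D ζ ↔ AllWindowsPositive ζ`-type
  statements for every small-at-high-sampling profile; the height-floored profile `flooredProfile win = 1/(1 + a)`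
  qualifies (`smallAtHighSampling_flooredProfile`) — the companion file `PfPersistenceFlooredTubes` shows its tube is
  G1-contU, closing the U-existence question typed open in ESCAPE-DOORS E1.
-/

set_option linter.dupNamespace false  -- the mandated namespace repeats `RiemannHypothesis`

noncomputable section

open Real Finset Filter Topology

namespace Summit.RiemannHypothesis.RiemannHypothesis.Theorems.PfPersistence

/-! ## §1 Diagonal entries at the sampling windows -/

/-- PROVED: `θ_{nn}^{(L)}(y) = (L − y)/L · cos(2πny/L) − sin(2πny/L)/(2πn)` for `n ≠ 0`. [folklore] -/
theorem thetaEven_diag_apply (L : ℝ) {n : ℕ} (hn : n ≠ 0) (y : ℝ) :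
    thetaEven L n n y
      = (L - y) / L * Real.cos (2 * π * n * y / L) - Real.sin (2 * π * n * y / L) / (2 * π * n) := by
  simp [thetaEven, hn]

/-- PROVED: the diagonal pattern value at the sampling height `ℓ_Q` in terms of the sampling angle. [folklore] -/
theorem thetaEven_samplingLog_diag (Q : ℕ) {n : ℕ} (hn : n ≠ 0) (q : ℕ) :
    thetaEven (samplingLog Q) n n (Real.log q)
      = (samplingLog Q - Real.log q) / samplingLog Q * Real.cos (n * samplingAngle Q q)
        - Real.sin (n * samplingAngle Q q) / (2 * π * n) := by
  rw [thetaEven_diag_apply _ hn,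
    show 2 * π * (n : ℝ) * Real.log q / samplingLog Q = n * samplingAngle Q q by unfold samplingAngle; ring]

/-- The DIAGONAL DEVIATION of `w` from `w₀` at height `Q`, mode `n` (the `(n, n)` entry of `d_w − d_{w₀}` at every
sampling window of order `Q` and rank `N ≥ n`). [folklore] -/
def diagDev (Q : ℕ) (w w₀ : Weights) (n : ℕ) : ℝ :=
  -2 * ∑ q ∈ Finset.range (Q + 2), (w q - w₀ q) * thetaEven (samplingLog Q) n n (Real.log q)

/-- PROVED: the `(n, n)` entry of `d_w − d_{w₀}` at `samplingWindow Q N` (`n ≤ N`) is `diagDev Q w w₀ n`. [folklore] -/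
theorem datumOf_sub_samplingWindow_diag (w w₀ : Weights) (Q : ℕ) {N n : ℕ} (hn : n < N + 1) :
    datumOf w (samplingWindow Q N) ⟨n, hn⟩ ⟨n, hn⟩ - datumOf w₀ (samplingWindow Q N) ⟨n, hn⟩ ⟨n, hn⟩
      = diagDev Q w w₀ n := by
  rw [datumOf_sub_entry, primeRange_samplingWindow, two_mul_samplingWindow_a]
  rfl

/-- PROVED: inside the tube, every diagonal deviation is below the radius of every sampling window of rank `≥ n`.
[folklore] -/
theorem abs_diagDev_lt {r : Window → ℝ} {w w₀ : Weights} (h : datumOf w ∈ entryTube r (datumOf w₀)) (Q : ℕ)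
    {N n : ℕ} (hn : n ≤ N) : |diagDev Q w w₀ n| < r (samplingWindow Q N) := by
  rw [← datumOf_sub_samplingWindow_diag w w₀ Q (Nat.lt_succ_of_le hn)]
  exact h _ _ _

/-- The height-`Q` cosine coefficient of slot `q`: `c_q = Δ_q (ℓ_Q − log q)/ℓ_Q`. [folklore] -/
def cosCoeff (Q : ℕ) (w w₀ : Weights) (q : ℕ) : ℝ :=
  (w q - w₀ q) * ((samplingLog Q - Real.log q) / samplingLog Q)

/-- PROVED: at the lag-`0` slots the coefficient is the bare deviation. [folklore] -/
theorem cosCoeff_of_log_eq_zero (Q : ℕ) (w w₀ : Weights) {q : ℕ} (hq : Real.log q = 0) :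
    cosCoeff Q w w₀ q = w q - w₀ q := by
  rw [cosCoeff, hq, sub_zero, div_self (samplingLog_pos Q).ne', mul_one]

/-- PROVED: `diagDev = −2 C(n) + S(n)/(πn)` for `n ≠ 0`. [folklore] -/
theorem diagDev_eq (Q : ℕ) (w w₀ : Weights) {n : ℕ} (hn : n ≠ 0) :
    diagDev Q w w₀ n
      = -2 * ∑ q ∈ Finset.range (Q + 2), cosCoeff Q w w₀ q * Real.cos (n * samplingAngle Q q)
        + (∑ q ∈ Finset.range (Q + 2), (w q - w₀ q) * Real.sin (n * samplingAngle Q q)) / (π * n) := by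
  have hπn : (π * n : ℝ) ≠ 0 := by positivity
  have h : ∀ q ∈ Finset.range (Q + 2), (w q - w₀ q) * thetaEven (samplingLog Q) n n (Real.log q)
      = cosCoeff Q w w₀ q * Real.cos (n * samplingAngle Q q)
        - (w q - w₀ q) * Real.sin (n * samplingAngle Q q) / (2 * π * n) := fun q _ => by
    rw [thetaEven_samplingLog_diag Q hn, cosCoeff]; ring
  rw [diagDev, Finset.sum_congr rfl h, Finset.sum_sub_distrib, ← Finset.sum_div]
  field_simp
  ring

/-- PROVED: splitting the slot range `{0, …, Q+1} = {0, 1} ∪ [2, Q+2)`. [folklore] -/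
theorem sum_range_eq_add_sum_Ico (Q : ℕ) (F : ℕ → ℝ) :
    ∑ q ∈ Finset.range (Q + 2), F q = F 0 + F 1 + ∑ q ∈ Finset.Ico 2 (Q + 2), F q := by
  rw [Finset.range_eq_Ico, ← Finset.sum_Ico_consecutive F (show 0 ≤ 2 by omega) (show 2 ≤ Q + 2 by omega),
    Nat.Ico_zero_eq_range, Finset.sum_range_succ, Finset.sum_range_succ, Finset.sum_range_zero, zero_add]

/-- PROVED: the cosine sum in constant-plus-`Fintype` form over the slots `[2, Q+2)`. [folklore] -/
theorem cosSum_eq (Q : ℕ) (w w₀ : Weights) (n : ℕ) :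
    ∑ q ∈ Finset.range (Q + 2), cosCoeff Q w w₀ q * Real.cos (n * samplingAngle Q q)
      = (w 0 - w₀ 0 + (w 1 - w₀ 1))
        + ∑ k : ↥(Finset.Ico 2 (Q + 2)), cosCoeff Q w w₀ k * Real.cos (n * samplingAngle Q k) := by
  rw [sum_range_eq_add_sum_Ico, samplingAngle_zero, samplingAngle_one, mul_zero, Real.cos_zero, mul_one, mul_one,
    cosCoeff_of_log_eq_zero Q w w₀ (by simp), cosCoeff_of_log_eq_zero Q w w₀ (by simp),
    Finset.sum_coe_sort (Finset.Ico 2 (Q + 2)) (fun q => cosCoeff Q w w₀ q * Real.cos (n * samplingAngle Q q))]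

/-! ## §2 The trace theorem for small-at-high-sampling profiles -/

/-- PROVED (height-`Q` step): if `|diagDev Q n| < ρ` for all `n`, then `|c_q| ≤ 2ρ` on `[2, Q+2)` and
`|Δ_0 + Δ_1| ≤ ρ` — the mean-square coefficient bound applied to `C(n)`, which tube membership bounds by
`ρ/2 + (Σ|Δ|)/(2πn) ≤ ρ` for large `n`. [folklore] -/
theorem cosCoeff_le_of_diag_close (Q : ℕ) {ρ : ℝ} {w w₀ : Weights} (hclose : ∀ n, |diagDev Q w w₀ n| < ρ) :
    (∀ k : ↥(Finset.Ico 2 (Q + 2)), |cosCoeff Q w w₀ k| ≤ 2 * ρ) ∧ |w 0 - w₀ 0 + (w 1 - w₀ 1)| ≤ ρ := by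
  have hρ : 0 < ρ := (abs_nonneg _).trans_lt (hclose 0)
  set B : ℝ := ∑ q ∈ Finset.range (Q + 2), |w q - w₀ q| with hB
  have hS : ∀ n : ℕ, |∑ q ∈ Finset.range (Q + 2), (w q - w₀ q) * Real.sin (n * samplingAngle Q q)| ≤ B :=
    fun n => (Finset.abs_sum_le_sum_abs _ _).trans (Finset.sum_le_sum fun q _ => by
      rw [abs_mul]; exact mul_le_of_le_one_right (abs_nonneg _) (Real.abs_sin_le_one _))
  -- eventual bound on the cosine sum
  have hev : ∀ᶠ n : ℕ in atTop, |(w 0 - w₀ 0 + (w 1 - w₀ 1))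
      + ∑ k : ↥(Finset.Ico 2 (Q + 2)), cosCoeff Q w w₀ k * Real.cos (n * samplingAngle Q k)| ≤ ρ := by
    obtain ⟨n₁, hn₁⟩ := exists_nat_gt (B / (π * ρ))
    refine eventually_atTop.2 ⟨n₁ + 1, fun n hn => ?_⟩
    have hn0 : n ≠ 0 := by omega
    have hnpos : (0 : ℝ) < n := by exact_mod_cast Nat.pos_of_ne_zero hn0
    rw [← cosSum_eq]
    have hd := hclose n
    rw [diagDev_eq Q w w₀ hn0] at hd
    have hSn : |(∑ q ∈ Finset.range (Q + 2), (w q - w₀ q) * Real.sin (n * samplingAngle Q q)) / (π * n)|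
        ≤ B / (π * n) := by
      rw [abs_div, abs_of_pos (by positivity : (0 : ℝ) < π * n)]
      exact div_le_div_of_nonneg_right (hS n) (by positivity)
    have hBn : B / (π * n) ≤ ρ := by
      rw [div_le_iff₀ (by positivity)]
      have h1 : B / (π * ρ) < n := hn₁.trans (by exact_mod_cast (show n₁ < n by omega))
      rw [div_lt_iff₀ (by positivity)] at h1
      linarith
    have key : ∀ C S d : ℝ, d = -2 * C + S → |d| < ρ → |S| ≤ ρ → |C| ≤ ρ := fun C S d h1 h2 h3 => by
      rw [abs_le]; rw [abs_lt] at h2; rw [abs_le] at h3; constructor <;> linarith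
    exact key _ _ _ rfl hd (hSn.trans hBn)
  -- node hypotheses
  have hI : ∀ k : ↥(Finset.Ico 2 (Q + 2)), 2 ≤ (k : ℕ) ∧ (k : ℕ) < Q + 2 := fun k => Finset.mem_Ico.1 k.2
  have hω : ∀ k : ↥(Finset.Ico 2 (Q + 2)), 0 < samplingAngle Q k ∧ samplingAngle Q k < 2 * π := fun k =>
    ⟨samplingAngle_pos Q (hI k).1, samplingAngle_lt_two_pi Q (by have := (hI k).2; omega)⟩
  have hinj : Function.Injective fun k : ↥(Finset.Ico 2 (Q + 2)) => samplingAngle Q k := fun k l h =>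
    Subtype.ext (samplingAngle_inj Q (by have := (hI k).1; omega) (by have := (hI l).1; omega) h)
  have hsum : ∀ k l : ↥(Finset.Ico 2 (Q + 2)), samplingAngle Q k + samplingAngle Q l ≠ 2 * π := fun k l =>
    samplingAngle_add_ne_two_pi Q (by have := (hI k).1; omega) (by have := (hI l).1; omega)
  exact cosSum_coeff_le (c := fun k : ↥(Finset.Ico 2 (Q + 2)) => cosCoeff Q w w₀ k) hω hinj hsum hρ.le hev

/-- PROVED: `ℓ_Q ≥ 2 log q` once `Q ≥ q²`. [folklore] -/
theorem two_mul_log_le_samplingLog {q Q : ℕ} (hq : 1 ≤ q) (hQ : q * q ≤ Q) :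
    2 * Real.log q ≤ samplingLog Q := by
  have hq0 : (0 : ℝ) < q := by exact_mod_cast hq
  rw [samplingLog, ← Real.log_rpow hq0, show ((q : ℝ) ^ (2 : ℝ)) = (q : ℝ) * q by norm_cast; ring]
  refine Real.log_le_log (by positivity) ?_
  have : ((q * q : ℕ) : ℝ) ≤ Q := by exact_mod_cast hQ
  push_cast at this
  linarith

/-- **PROVED — DIAGONAL CLOSENESS AT ALL LARGE HEIGHTS FORCES EQUAL WEIGHTS.** If `|diagDev Q w w₀ n| < ρ_Q` for all
`Q, n` with `ρ_Q → 0`, then `w = w₀` on `q ≥ 2` and `w 0 + w 1 = w₀ 0 + w₀ 1`. [folklore] -/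
theorem weights_eq_of_diag_close {ρ : ℕ → ℝ} (hρ : Tendsto ρ atTop (𝓝 0)) {w w₀ : Weights}
    (hclose : ∀ Q n, |diagDev Q w w₀ n| < ρ Q) :
    (∀ q, 2 ≤ q → w q = w₀ q) ∧ w 0 + w 1 = w₀ 0 + w₀ 1 := by
  refine ⟨fun q hq => ?_, ?_⟩
  · -- at heights `Q ≥ q²`: `|Δ_q| ≤ 4 ρ_Q`
    have hev : ∀ᶠ Q : ℕ in atTop, |w q - w₀ q| ≤ 4 * ρ Q := by
      refine eventually_atTop.2 ⟨q * q, fun Q hQ => ?_⟩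
      have hqQ : q < Q + 2 := by nlinarith
      have h1 := (cosCoeff_le_of_diag_close Q (hclose Q)).1 ⟨q, Finset.mem_Ico.2 ⟨hq, hqQ⟩⟩
      simp only [cosCoeff, abs_mul] at h1
      have hℓ := samplingLog_pos Q
      have hfac : 1 / 2 ≤ (samplingLog Q - Real.log q) / samplingLog Q := by
        rw [div_le_div_iff₀ two_pos hℓ]
        have := two_mul_log_le_samplingLog (show 1 ≤ q by omega) hQ
        linarith
      rw [abs_of_nonneg (by linarith : (0 : ℝ) ≤ (samplingLog Q - Real.log q) / samplingLog Q)] at h1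
      have h2 : |w q - w₀ q| * (1 / 2) ≤ 2 * ρ Q :=
        (mul_le_mul_of_nonneg_left hfac (abs_nonneg _)).trans h1
      linarith
    have h0 : |w q - w₀ q| ≤ 0 := ge_of_tendsto (by simpa using hρ.const_mul 4) hev
    exact sub_eq_zero.1 (abs_nonpos_iff.1 h0)
  · have hev : ∀ᶠ Q : ℕ in atTop, |w 0 - w₀ 0 + (w 1 - w₀ 1)| ≤ ρ Q :=
      Filter.Eventually.of_forall fun Q => (cosCoeff_le_of_diag_close Q (hclose Q)).2
    have h0 : |w 0 - w₀ 0 + (w 1 - w₀ 1)| ≤ 0 := ge_of_tendsto hρ hev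
    have := abs_nonpos_iff.1 h0
    linarith

/-- A radius profile is SMALL AT HIGH SAMPLING if at every sampling height it gets, at arbitrarily large ranks,
below a height-threshold `ρ_Q → 0` (it may stay floored at every bounded height). [folklore] -/
def SmallAtHighSampling (r : Window → ℝ) : Prop :=
  ∃ ρ : ℕ → ℝ, Tendsto ρ atTop (𝓝 0) ∧ ∀ Q n : ℕ, ∃ N, n ≤ N ∧ r (samplingWindow Q N) ≤ ρ Q

/-- **PROVED — TRACE THEOREM (vanishing tubes).** An arithmetic datum in a small-at-high-sampling entry tube about
an arithmetic datum IS the centre. [folklore] -/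
theorem datumOf_eq_of_mem_entryTube_of_small {r : Window → ℝ} (hr : SmallAtHighSampling r) {w w₀ : Weights}
    (h : datumOf w ∈ entryTube r (datumOf w₀)) : datumOf w = datumOf w₀ := by
  obtain ⟨ρ, hρ, hN⟩ := hr
  have hclose : ∀ Q n, |diagDev Q w w₀ n| < ρ Q := fun Q n => by
    obtain ⟨N, hnN, hle⟩ := hN Q n
    exact (abs_diagDev_lt h Q hnN).trans_le hle
  obtain ⟨h2, h01⟩ := weights_eq_of_diag_close hρ hclose
  exact datumOf_eq_of_weights_eq h2 h01

/-- PROVED: thin-in-rank profiles are small at high sampling (so this file extends `PfPersistenceThinTubeTrace`).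
[folklore] -/
theorem smallAtHighSampling_of_thin {r : Window → ℝ} (hr : ThinAtSamplingHeights r) (hr0 : ∀ win, 0 < r win) :
    SmallAtHighSampling r := by
  refine ⟨fun Q => 1 / ((Q : ℝ) + 1), tendsto_one_div_add_atTop_nhds_zero_nat, fun Q n => ?_⟩
  have ht := tendsto_zero_of_thin (hr Q) fun N => (hr0 _).le
  obtain ⟨N, hN⟩ := ((ht.eventually (eventually_lt_nhds (by positivity : (0 : ℝ) < 1 / ((Q : ℝ) + 1)))).and
    (eventually_ge_atTop n)).exists
  exact ⟨N, hN.2, hN.1.le⟩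

/-! ## §3 Corollaries: trace `{ζ}`, separation, and a height-floored qualifying profile -/

/-- PROVED: the dial-space TRACE of a small-at-high-sampling tube about `ζ` is `{ζ}`. [folklore] -/
theorem entryTube_zeta_inter_dialSpace_of_small {r : Window → ℝ} (hr : SmallAtHighSampling r) {d : Datum}
    (hd : d ∈ dialSpace) (hdT : d ∈ entryTube r zetaDatum) : d = zetaDatum := by
  obtain ⟨w, rfl⟩ := hd
  exact datumOf_eq_of_mem_entryTube_of_small hr hdT

/-- PROVED: as sets, `entryTube r ζ ∩ dialSpace = {ζ}`. [folklore] -/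
theorem entryTube_inter_dialSpace_eq_of_small {r : Window → ℝ} (hr : SmallAtHighSampling r)
    (hr0 : ∀ win, 0 < r win) : entryTube r zetaDatum ∩ dialSpace = {zetaDatum} := by
  ext d
  refine ⟨fun hd => entryTube_zeta_inter_dialSpace_of_small hr hd.2 hd.1, fun hd => ?_⟩
  rw [Set.mem_singleton_iff.1 hd]
  exact ⟨mem_entryTube_self hr0 _, zetaDatum_mem_dialSpace⟩

/-- **PROVED — SEPARATION BY A VANISHING TUBE ≡ `𝒫`-MEMBERSHIP OF `ζ`.** For `D ⊆ dialSpace` containing `ζ` and any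
positive small-at-high-sampling profile: `entryTube r ζ` separates `ζ` from `D`'s negatives iff `ζ` is all-window
positive. [folklore] -/
theorem separates_entryTube_zeta_iff_of_small {r : Window → ℝ} (hr : SmallAtHighSampling r)
    (hr0 : ∀ win, 0 < r win) {D : Set Datum} (hζ : zetaDatum ∈ D) (hD : D ⊆ dialSpace) :
    Separates (entryTube r zetaDatum) D zetaDatum ↔ AllWindowsPositive zetaDatum := by
  refine ⟨fun h => h.allWindowsPositive hζ, fun hpos => ⟨mem_entryTube_self hr0 _, fun d hd hneg hdT => ?_⟩⟩
  rw [entryTube_zeta_inter_dialSpace_of_small hr (hD hd) hdT] at hneg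
  exact (detectablyNegative_iff_not_allWindowsPositive _).1 hneg hpos

/-- The HEIGHT-FLOORED profile `r(win) = 1/(1 + a)`: bounded below on every bounded height range, `→ 0` only as the
height `a → ∞` (no dependence on the rank). [folklore] -/
def flooredProfile : Window → ℝ := fun win => 1 / (1 + win.a)

/-- PROVED: positive. [folklore] -/
theorem flooredProfile_pos (win : Window) : 0 < flooredProfile win := by
  have := win.ha; unfold flooredProfile; positivity

/-- PROVED: floored on every bounded height range (`a ≤ A ⟹ r ≥ 1/(1 + A)`). [folklore] -/
theorem flooredProfile_floor (A : ℝ) :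
    ∃ m : ℝ, 0 < m ∧ ∀ win : Window, win.a ≤ A → m ≤ flooredProfile win := by
  refine ⟨1 / (1 + max A 0), by positivity, fun win hwin => ?_⟩
  have := win.ha
  unfold flooredProfile
  exact one_div_le_one_div_of_le (by positivity) (by linarith [le_max_left A 0])

/-- PROVED: `ℓ_Q → ∞`. [folklore] -/
theorem tendsto_samplingLog_atTop : Tendsto samplingLog atTop atTop :=
  Real.tendsto_log_atTop.comp (tendsto_atTop_add_const_right _ _ tendsto_natCast_atTop_atTop)

/-- PROVED: the floored profile is small at high sampling (`r(samplingWindow Q N) = 1/(1 + ℓ_Q/2) → 0`). [folklore] -/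
theorem smallAtHighSampling_flooredProfile : SmallAtHighSampling flooredProfile := by
  refine ⟨fun Q => 1 / (1 + samplingLog Q / 2), ?_, fun Q n => ⟨n, le_rfl, le_of_eq rfl⟩⟩
  exact tendsto_const_nhds.div_atTop
    (tendsto_atTop_add_const_left _ _ (tendsto_samplingLog_atTop.atTop_div_const two_pos))

/-- PROVED: the floored tube's dial-space trace is `{ζ}`. [folklore] -/
theorem flooredTube_inter_dialSpace : entryTube flooredProfile zetaDatum ∩ dialSpace = {zetaDatum} :=
  entryTube_inter_dialSpace_eq_of_small smallAtHighSampling_flooredProfile flooredProfile_pos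

end Summit.RiemannHypothesis.RiemannHypothesis.Theorems.PfPersistence

end
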